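import Literature.Computability.Complexity.LundYannakakisProofs
import Literature.Computability.Complexity.LundYannakakisSoundness
import HarnessLib

/-!
# The Lund–Yannakakis reduction, IV: Arora–Barak 2009, Thm. 22.31 discharged

Topic `Computability/Complexity`, namespace `Literature.Computability.Complexity`. The last link
of the chain under the named fact `AroraBarak2009_thm2231` of `LundYannakakis.lean` (Thm. 22.31:
for `0 < ε`, `0 < c`, `16 c² ε ≤ 1`, gap label cover `gapLabelCover W ε` Karp-reduces to gap
exact set cover `gapSetCover c`):

* `LundYannakakis.lean` — the construction `lyReduce`, the patched map `lyMap W`, completeness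
  (`lyReduce_mem_yesSet`: a satisfying assignment gives an exact cover of size `n`);
* `LundYannakakisGadget.lean`, `LundYannakakisSoundness.lean` — soundness: the complementary
  pair of the hypercube gadget, the averaging step and the convexity bound `n² < ε |T|²`
  (`lyReduce_mem_noSet`), assembled as `AroraBarak2009_thm2231_of_FP : lyMap_mem_FP → …`;
* `LundYannakakisProofs.lean` — the implementation fact `lyMap_mem_FP_holds` (the map is
  computed on codes by an `FP` brick assembly);
* this file — **`AroraBarak2009_thm2231_holds`**. It is kept separate so that the combinatorial
  files do not import the brick-algebra closure of the machine file and vice versa.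

## References

* S. Arora, B. Barak, *Computational Complexity: A Modern Approach*, CUP 2009, §22.8,
  Thm. 22.31 (p. 486), Def. 22.32 and the proof (pp. 486–488).
* C. Lund, M. Yannakakis, *On the hardness of approximating minimization problems*, J. ACM 41
  (1994) 960–981, §3.
-/

namespace Literature.Computability.Complexity

/-- **Arora–Barak 2009, Thm. 22.31 (Lund–Yannakakis 1994), discharged**: for every `W`, every
`ε > 0` and every rational `c > 0` with `16 c² ε ≤ 1` (i.e. `c ≤ 1/(4√ε)`, the printed `T`), the
gap label cover problem `gapLabelCover W ε` on regular projection instances Karp-reduces to gap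
exact set cover `gapSetCover c` (YES: an exact cover of size `K = n ≥ 1`; NO: every cover has at
least `c K` sets) — `AroraBarak2009_thm2231_of_FP` applied to `lyMap_mem_FP_holds`.
[cite: AroraBarak2009, Thm. 22.31 (§22.8, p. 486)] -/
theorem AroraBarak2009_thm2231_holds : AroraBarak2009_thm2231 :=
  AroraBarak2009_thm2231_of_FP lyMap_mem_FP_holds

end Literature.Computability.Complexity
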